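import Summits.Ventures.CertifiedQuantumChemistry.Rows.APosterioriLowerBound
import Literature.MathematicalPhysics.QuantumChemistry.DualConeLowerBound
import Literature.Computation.Certificates.DyadicEigCertificate
import HarnessLib

/-!
# Ventures/CertifiedQuantumChemistry — Rows/APosterioriLowerBoundConditions.lean: the a-posteriori bridge for an
# ARBITRARY necessary condition set (sibling of `Rows/APosterioriLowerBound.lean`, LADDER-CHEM I-TYPE slot 08)

HONEST FRAMING (verbatim, page 1 of every file of the cell): certified bounds for a stated model
Hamiltonian in a stated basis; not a claim about the real molecule or material beyond that model.

WHAT THIS FILE IS. `Rows/APosterioriLowerBound.lean` (p457053) proves the bridge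
"inexact semidefinite dual + certified eigenvalue shifts + block trace bounds ⇒ `LowerRow`" from the
STATE-level encoding predicates `APosteriori.IsSectorRelaxation{,LMI}` and gives the 2-RDM-level form
`APosteriori.IsDQGEncoding` for the P, Q, G list only. The cell's slot-07 file
`Literature/MathematicalPhysics/QuantumChemistry/DualConeLowerBound.lean` (chem-type-07) has since put
the printed notion of an ARBITRARY necessary condition set into the tree —
`IsNecessaryInSector a b P` (Cancès–Stoltz–Lewin 2006 §3: "some necessary conditions for
N-representability are selected … `𝒞_app ⊃ 𝒞_N` … `E_app` is a lower bound to the full CI energy",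
eqs. (7)–(10), with the sector rows of Mazziotti 2007 §II.F) together with its closure under
conjunction / weakening and the instances P, Q, G (`isNecessaryInSector_isDQGFeasibleSector`) and
P, Q, G, T1, T2′ (`isNecessaryInSector_isDQGT1T2PrimeFeasibleSector`). This sibling PLUGS the two
together, so that a certificate produced for a programme carrying ANY list of necessary conditions
(D, Q, G, T1, T2, T2′, further linear rows …) has a named soundness decl:

* `APosteriori.IsEncodingOf F P C A rhs τ c₀` — the real block programme `(C, A, rhs)` with trace
  bounds `τ` and constant `c₀` ENCODES the condition set `P` (a predicate on abstract pairs `(γ, Γ)`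
  over the `2k` spin orbitals) for the model `F`: every `P`-feasible pair has a primal-feasible,
  trace-bounded image `X` with `c₀ + Σ_j ⟨C_j, X_j⟩ ≤ Re E[γ, Γ]` (`rdmEnergy` at `F`'s tables).
  `APosteriori.IsDQGEncoding` is literally the case `P = IsDQGFeasibleSector a b`
  (`isDQGEncoding_iff_isEncodingOf`); `IsEncodingOf.anti`: an encoding of `P` encodes every
  STRONGER list `Q ⇒ P` (adding conditions to the pairs, not to the programme).
* `IsEncodingOf.isSectorRelaxation` — an encoding of a SECTOR-NECESSARY list
  (`IsNecessaryInSector a b P`) is a state-level encoding `IsSectorRelaxation` (the RDM pair of a unit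
  sector vector is `P`-feasible; `rdmEnergy_rdm`);
  `lowerRow_of_isEncodingOf_of_forall` — hence ANY number below the objective on the primal-feasible
  trace-bounded set is a `LowerRow` (CSL's `E_app ≤ E` through the programme; the slot-07 plug);
  `lowerRow_of_isEncodingOf` — **THE BRIDGE for an arbitrary necessary condition set**: encoding +
  necessity + any `ỹ` + certified shifts `d_j` (`C_j − Σ_i ỹ_i A_ij − d_j·1 ⪰ 0`) ⇒ `LowerRow F a b lo`
  for `lo ≤ c₀ + rhsᵀỹ + Σ_j min(d_j, 0) · τ_j` (Jansson 2007 Cor. 7.1 (a) in the tree's trace form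
  `JanssonChaykinKeil.theorem_3_2_traceBound`, via `APosteriori.lowerRow_of_isSectorRelaxation`).
* `APosteriori.IsEncodingOfLMI` / `IsEncodingOfLMI.isSectorRelaxationLMI` / `lowerRow_of_isEncodingOfLMI`
  — the same three for the inequality (LMI, "dual-type") form whose variables are the RDM entries
  (`APosteriori.IsSectorRelaxationLMI`, `JanssonChaykinKeil.lmiForm_bound`).
* `APosteriori.lowerRow_of_dyadicEigCertificate` — THE READER-SHAPED END-TO-END STATEMENT: an LMI
  encoding (`IsSectorRelaxationLMI`) + a `certsdp-conic/1` certificate in PSD mode `dyadic-eig`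
  (multipliers `λ`, `κ ≥ 0`, real symmetric `Z_k` each with a Cholesky-residual witness
  `(R_k, d_k > 0, t_k > 0, σ_k, r_k)`, exact residuals `r_v`, `β`) ⇒ `LowerRow F a b lo` for
  `lo ≤ β − Σ_{v≠u} |r_v| ρ_v − Σ_k |min(0, (t_k σ_k − r_k)/(t_k² d_k))| τ_k` — the composition of
  certnum's `Literature.Computation.Certificates.DyadicEigCertificate.bound` (Jansson–Chaykin–Keil
  `lmiForm_bound` ∘ Rump's residual witness `DyadicCholResidualWitness.posSemidef_sub_smul_one`) with
  the sector ground state; its hypotheses are exactly a reader's checks plus the encoding property.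

PRECISION NOTE (chem-ref-4 ask 08-1, applies to this file and to `APosterioriLowerBound.lean`): the
numbering "Lemma 3.1 / Thm 3.2" of Jansson–Chaykin–Keil, SIAM J. Numer. Anal. 46, is quoted as
recorded in the tree file `SemidefiniteRigorousBounds.lean`; the SIAM print is not held (acq-09252) and
its verbatim audit is certnum-ref-2's; the pages opened by this typer are Jansson 2007 (arXiv) and
Mazziotti 2007 / Cancès–Stoltz–Lewin 2006 as listed below.

Everything is PROVED (0 sorry); the two `def`s are parametrised predicates that assert nothing; no
decl of `DualConeLowerBound.lean`, `SemidefiniteRigorousBounds.lean` or `APosterioriLowerBound.lean` is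
restated (all imported and cited by name). WHAT THIS FILE IS NOT: not a proof that a given
generator's programme encodes a given list (per generator, outside this file: readers A ≡ B of record
or a Lean proof for literal models); not a certificate of any floating-point producer; not a claim
beyond the pinned model.

References (pages opened 2026-08-26 by chem-type-08): E. Cancès, G. Stoltz, M. Lewin, *The electronic
ground-state energy problem: a new reduced density matrix approach*, J. Chem. Phys. 125 (2006) 064101,
arXiv:quant-ph/0602042, §3 eqs. (7)–(10) [p.5 of the held text] [CancesStoltzLewin2006]; C. Jansson,
arXiv:0707.4366 (2007) §7 Cor. 7.1 p.14 [Jansson2007]; D. A. Mazziotti (2007) Ch. 3 §III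
eqs. (107)–(111) p.54–55 [Mazziotti2007RDMChapter]; the witness lemma's source S. M. Rump (1999)
[Rump1999VerifiedLargeSystems] and [JanssonChaykinKeil2008] are cited THROUGH the tree decls composed
(`DyadicEigCertificate.bound`, `lmiForm_bound`), not read by this typer.
-/

namespace Summit.Ventures.CertifiedQuantumChemistry

open Matrix Finset
open Literature.MathematicalPhysics.QuantumLattice Literature.MathematicalPhysics.QuantumChemistry
open Literature.Computation.Certificates

namespace APosteriori

variable {k : ℕ}

/-- A condition set on abstract RDM pairs over the `2k` spin orbitals of a `k`-orbital model
(plumbing abbreviation for the type of `P`; e.g. `IsDQGFeasibleSector a b`,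
`IsDQGT1T2PrimeFeasibleSector a b`, `QCondition`, conjunctions thereof).
[cite: CancesStoltzLewin2006, §3 eq. (7)] -/
abbrev PairCondition (k : ℕ) : Type :=
  Matrix (Orb (Fin k)) (Orb (Fin k)) ℂ → Matrix (Orb (Fin k) × Orb (Fin k)) (Orb (Fin k) × Orb (Fin k)) ℂ → Prop

/-! ## Equality (block) form -/

section EqualityForm

variable {ι : Type*} [Fintype ι] {σ : ι → Type*} [∀ j, Fintype (σ j)] [∀ j, DecidableEq (σ j)]
  {μ : Type*} [Fintype μ]

/-- **ENCODING OF A CONDITION SET (equality form).** The real block programme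
`min c₀ + Σ_j ⟨C_j, X_j⟩ s.t. Σ_j ⟨A_ij, X_j⟩ = rhs_i, X_j ⪰ 0` with block trace bounds `τ_j` ENCODES
the condition set `P` for the model `F`: every `P`-feasible pair `(γ, Γ)` has a primal-feasible image
`X` with `tr X_j ≤ τ_j` and `c₀ + Σ_j ⟨C_j, X_j⟩ ≤ Re E[γ, Γ]`, `E` the energy functional of `F`'s
exact-rational tables — the programme computing (a lower relaxation of) CSL's
`E_app = inf {tr(K_N Γ) : Γ ∈ 𝒞_app, tr Γ = N(N−1)}` for `𝒞_app` the set cut out by `P` (their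
eq. (9)), written as a PROPERTY of arbitrary data `(C, A, rhs, τ, c₀)` as in Mazziotti's primal
formulation (107)–(110). Asserts nothing.
[cite: CancesStoltzLewin2006, §3 eqs. (7), (9)] [cite: Mazziotti2007RDMChapter, Ch. 3 §III eqs. (107)-(110), p.54] -/
def IsEncodingOf (F : Model k) (P : PairCondition k) (C : ∀ j, Matrix (σ j) (σ j) ℝ)
    (A : μ → ∀ j, Matrix (σ j) (σ j) ℝ) (rhs : μ → ℝ) (τ : ι → ℝ) (c₀ : ℝ) : Prop :=
  ∀ γ Γ, P γ Γ →
    ∃ X : ∀ j, Matrix (σ j) (σ j) ℝ,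
      (∀ j, (X j).PosSemidef) ∧ (∀ i, ∑ j, (A i j * X j).trace = rhs i) ∧
        (∀ j, (X j).trace ≤ τ j) ∧
        c₀ + ∑ j, (C j * X j).trace ≤
          (rdmEnergy (fun p q => (F.h p q : ℂ)) (fun p q r s => (F.eri p q r s : ℂ)) (F.ecore : ℂ)
            γ Γ).re

omit [∀ j, DecidableEq (σ j)] [Fintype μ] in
/-- `APosteriori.IsDQGEncoding` IS the encoding of the sector P, Q, G list `IsDQGFeasibleSector a b`
(definitional). [cite: Mazziotti2007RDMChapter, Ch. 3 §III eqs. (107)-(110), p.54] -/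
theorem isDQGEncoding_iff_isEncodingOf (F : Model k) (a b : ℕ) (C : ∀ j, Matrix (σ j) (σ j) ℝ)
    (A : μ → ∀ j, Matrix (σ j) (σ j) ℝ) (rhs : μ → ℝ) (τ : ι → ℝ) (c₀ : ℝ) :
    IsDQGEncoding F a b C A rhs τ c₀ ↔ IsEncodingOf F (IsDQGFeasibleSector a b) C A rhs τ c₀ :=
  Iff.rfl

omit [∀ j, DecidableEq (σ j)] [Fintype μ] in
/-- **Adding conditions on the pairs keeps an encoding**: a programme encoding the list `P` encodes
every stronger list `Q` (`Q ⇒ P`; the `Q`-feasible set is smaller — "Additional necessary conditions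
can be considered"). [cite: CancesStoltzLewin2006, §3 eq. (7)] -/
theorem IsEncodingOf.anti {F : Model k} {P Q : PairCondition k} {C : ∀ j, Matrix (σ j) (σ j) ℝ}
    {A : μ → ∀ j, Matrix (σ j) (σ j) ℝ} {rhs : μ → ℝ} {τ : ι → ℝ} {c₀ : ℝ}
    (h : IsEncodingOf F P C A rhs τ c₀) (hQP : ∀ γ Γ, Q γ Γ → P γ Γ) :
    IsEncodingOf F Q C A rhs τ c₀ :=
  fun γ Γ hQ => h γ Γ (hQP γ Γ hQ)

omit [∀ j, DecidableEq (σ j)] [Fintype μ] in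
/-- **An encoding of a SECTOR-NECESSARY condition set is a state-level encoding** of the `(a, b)`
sector energy (`APosteriori.IsSectorRelaxation`): the RDM pair of a unit vector of the sector is
`P`-feasible (`IsNecessaryInSector`, CSL's `𝒞_app ⊃ 𝒞_N`) and the energy functional there is
`⟨ψ, H_F ψ⟩` (`rdmEnergy_rdm`). [cite: CancesStoltzLewin2006, §3 eqs. (7), (9)-(10)] -/
theorem IsEncodingOf.isSectorRelaxation {F : Model k} {P : PairCondition k} {a b : ℕ}
    {C : ∀ j, Matrix (σ j) (σ j) ℝ} {A : μ → ∀ j, Matrix (σ j) (σ j) ℝ} {rhs : μ → ℝ} {τ : ι → ℝ}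
    {c₀ : ℝ} (h : IsEncodingOf F P C A rhs τ c₀) (hP : IsNecessaryInSector a b P) :
    IsSectorRelaxation F a b C A rhs τ c₀ := by
  intro ψ hψ hψ1
  obtain ⟨X, hX, hAX, hτ, hobj⟩ := h _ _ (hP ψ hψ hψ1)
  refine ⟨X, hX, hAX, hτ, ?_⟩
  rw [rdmEnergy_rdm _ _ _ hψ1] at hobj
  exact hobj

omit [∀ j, DecidableEq (σ j)] [Fintype μ] in
/-- **`E_app ≤ E` THROUGH THE PROGRAMME (the slot-07 plug).** For a symmetric model, `a, b ≤ k`, a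
programme encoding a sector-necessary list `P`: every rational below the objective
`c₀ + Σ_j ⟨C_j, X_j⟩` on the WHOLE primal-feasible trace-bounded set is a `LowerRow` — in particular
the programme's optimal value and any exactly dual-feasible value ("since `𝒞_app ⊃ 𝒞_N`, the energy
`E_app` is a lower bound to the full CI energy in the chosen basis, `E_app ≤ E`").
[cite: CancesStoltzLewin2006, §3 eqs. (9)-(10)] [cite: Mazziotti2007RDMChapter, Ch. 3 §III after eq. (111), p.55] -/
theorem lowerRow_of_isEncodingOf_of_forall {F : Model k} (hF : F.IsSymmetric) {P : PairCondition k}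
    {a b : ℕ} (ha : a ≤ k) (hb : b ≤ k) {C : ∀ j, Matrix (σ j) (σ j) ℝ}
    {A : μ → ∀ j, Matrix (σ j) (σ j) ℝ} {rhs : μ → ℝ} {τ : ι → ℝ} {c₀ : ℝ}
    (henc : IsEncodingOf F P C A rhs τ c₀) (hP : IsNecessaryInSector a b P) {lo : ℚ}
    (hlo : ∀ X : ∀ j, Matrix (σ j) (σ j) ℝ, (∀ j, (X j).PosSemidef) →
      (∀ i, ∑ j, (A i j * X j).trace = rhs i) → (∀ j, (X j).trace ≤ τ j) →
        ((lo : ℚ) : ℝ) ≤ c₀ + ∑ j, (C j * X j).trace) :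
    LowerRow F a b lo :=
  lowerRow_of_isSectorRelaxation_of_forall hF ha hb (henc.isSectorRelaxation hP) hlo

/-- **THE BRIDGE FOR AN ARBITRARY NECESSARY CONDITION SET (equality form).** Symmetric model `F`,
`a, b ≤ k`, a programme `(C, A, rhs)` with trace bounds `τ` encoding a sector-necessary list `P`
(D, Q, G, T1, T2′, … — any `IsNecessaryInSector a b P`). For ANY approximate dual vector `ỹ` and ANY
certified shifts `d_j` with `C_j − Σ_i ỹ_i A_ij − d_j·1 ⪰ 0`, every rational
`lo ≤ c₀ + Σ_i rhs_i ỹ_i + Σ_j min(d_j, 0) · τ_j` is a `LowerRow F a b lo` (Jansson 2007 Cor. 7.1 (a)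
"`f̂_p ≥ ⟨ỹ, b⟩ + Σ_j ⟨d_j⁻, x̄_j⟩`" in the tree's trace form, composed with `E_app ≤ E`). NOT COVERED:
the float producer of `ỹ`, the certification of `d_j`, the per-generator encoding property.
[cite: Jansson2007, §7 Cor. 7.1 (a), p.14] [cite: CancesStoltzLewin2006, §3 eqs. (9)-(10)] -/
theorem lowerRow_of_isEncodingOf {F : Model k} (hF : F.IsSymmetric) {P : PairCondition k} {a b : ℕ}
    (ha : a ≤ k) (hb : b ≤ k) {C : ∀ j, Matrix (σ j) (σ j) ℝ} {A : μ → ∀ j, Matrix (σ j) (σ j) ℝ}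
    {rhs : μ → ℝ} {τ : ι → ℝ} {c₀ : ℝ} (henc : IsEncodingOf F P C A rhs τ c₀)
    (hP : IsNecessaryInSector a b P) (y : μ → ℝ) (d : ι → ℝ)
    (hD : ∀ j, (C j - ∑ i, y i • A i j - d j • (1 : Matrix (σ j) (σ j) ℝ)).PosSemidef) {lo : ℚ}
    (hlo : ((lo : ℚ) : ℝ) ≤ c₀ + ∑ i, rhs i * y i + ∑ j, min (d j) 0 * τ j) :
    LowerRow F a b lo :=
  lowerRow_of_isSectorRelaxation hF ha hb (henc.isSectorRelaxation hP) y d hD hlo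

end EqualityForm

/-! ## Inequality (LMI) form: the RDM entries are the variables -/

section LMIForm

variable {V : Type*} [Fintype V] [DecidableEq V] {E : Type*} [Fintype E] {I : Type*} [Fintype I]
  {K : Type*} [Fintype K] {σ : K → Type*} [∀ q, Fintype (σ q)] [∀ q, DecidableEq (σ q)]

/-- **ENCODING OF A CONDITION SET (inequality / LMI form).** The programme in variables
`y : V → ℝ` (`y_u = 1`, boxes `|y_v| ≤ ρ_v` for `v ≠ u`, equality rows, inequality rows, blocks
`C_k + Σ_v y_v F_{k,v} ⪰ 0` with trace bounds `τ_k`, objective `Σ_v c_v y_v + c₀`) ENCODES the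
condition set `P` for the model `F`: every `P`-feasible pair `(γ, Γ)` has a feasible image `y` with
objective `≤ Re E[γ, Γ]` (the "dual-type" programme whose variables are the RDM entries themselves).
Asserts nothing. [cite: CancesStoltzLewin2006, §3 eqs. (7), (9)] [cite: Mazziotti2007RDMChapter, Ch. 3 §III eqs. (107)-(108), p.54] -/
def IsEncodingOfLMI (F : Model k) (P : PairCondition k) (c : V → ℝ) (c₀ : ℝ) (u : V)
    (rowE : E → V → ℝ) (rhs : E → ℝ) (rowI : I → V → ℝ) (upper : I → ℝ)
    (Cb : ∀ q, Matrix (σ q) (σ q) ℝ) (Fm : ∀ q, V → Matrix (σ q) (σ q) ℝ) (ρ : V → ℝ)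
    (τ : K → ℝ) : Prop :=
  ∀ γ Γ, P γ Γ →
    ∃ y : V → ℝ, y u = 1 ∧ (∀ v, v ≠ u → |y v| ≤ ρ v) ∧ (∀ r, ∑ v, rowE r v * y v = rhs r) ∧
      (∀ i, ∑ v, rowI i v * y v ≤ upper i) ∧ (∀ q, (Cb q + ∑ v, y v • Fm q v).PosSemidef) ∧
      (∀ q, (Cb q + ∑ v, y v • Fm q v).trace ≤ τ q) ∧
      ∑ v, c v * y v + c₀ ≤
        (rdmEnergy (fun p q => (F.h p q : ℂ)) (fun p q r s => (F.eri p q r s : ℂ)) (F.ecore : ℂ)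
          γ Γ).re

omit [DecidableEq V] [Fintype E] [Fintype I] [Fintype K] [∀ q, DecidableEq (σ q)] in
/-- An LMI-form encoding of a sector-necessary condition set is a state-level LMI encoding
(`APosteriori.IsSectorRelaxationLMI`). [cite: CancesStoltzLewin2006, §3 eqs. (7), (9)-(10)] -/
theorem IsEncodingOfLMI.isSectorRelaxationLMI {F : Model k} {P : PairCondition k} {a b : ℕ}
    {c : V → ℝ} {c₀ : ℝ} {u : V} {rowE : E → V → ℝ} {rhs : E → ℝ} {rowI : I → V → ℝ}
    {upper : I → ℝ} {Cb : ∀ q, Matrix (σ q) (σ q) ℝ} {Fm : ∀ q, V → Matrix (σ q) (σ q) ℝ}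
    {ρ : V → ℝ} {τ : K → ℝ} (h : IsEncodingOfLMI F P c c₀ u rowE rhs rowI upper Cb Fm ρ τ)
    (hP : IsNecessaryInSector a b P) :
    IsSectorRelaxationLMI F a b c c₀ u rowE rhs rowI upper Cb Fm ρ τ := by
  intro ψ hψ hψ1
  obtain ⟨y, hyu, hρ, heq, hineq, hpsd, hτ, hobj⟩ := h _ _ (hP ψ hψ hψ1)
  refine ⟨y, hyu, hρ, heq, hineq, hpsd, hτ, ?_⟩
  rw [rdmEnergy_rdm _ _ _ hψ1] at hobj
  exact hobj

/-- **THE BRIDGE FOR AN ARBITRARY NECESSARY CONDITION SET (LMI form).** Symmetric `F`, `a, b ≤ k`, an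
LMI-form programme encoding a sector-necessary list `P`; a certificate `(λ, κ ≥ 0, Z_k ⪰ d_k·1)` with
exact stationarity residuals `r_v` proves `LowerRow F a b lo` for every rational
`lo ≤ c₀ + r_u + Σ_r λ_r rhs_r − Σ_i κ_i upper_i − Σ_k ⟨Z_k, C_k⟩ − Σ_{v ≠ u} |r_v| ρ_v − Σ_k |min(0, d_k)| τ_k`
(the tree's `JanssonChaykinKeil.lmiForm_bound` via `APosteriori.lowerRow_of_isSectorRelaxationLMI`).
[cite: Jansson2007, §7 Cor. 7.1 (a), p.14] [cite: CancesStoltzLewin2006, §3 eqs. (9)-(10)] -/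
theorem lowerRow_of_isEncodingOfLMI {F : Model k} (hF : F.IsSymmetric) {P : PairCondition k}
    {a b : ℕ} (ha : a ≤ k) (hb : b ≤ k) {c : V → ℝ} {c₀ : ℝ} {u : V} {rowE : E → V → ℝ}
    {rhs : E → ℝ} {rowI : I → V → ℝ} {upper : I → ℝ} {Cb : ∀ q, Matrix (σ q) (σ q) ℝ}
    {Fm : ∀ q, V → Matrix (σ q) (σ q) ℝ} {ρ : V → ℝ} {τ : K → ℝ}
    (henc : IsEncodingOfLMI F P c c₀ u rowE rhs rowI upper Cb Fm ρ τ)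
    (hP : IsNecessaryInSector a b P) (lam : E → ℝ) (κ : I → ℝ) (hκ : ∀ i, 0 ≤ κ i)
    (Z : ∀ q, Matrix (σ q) (σ q) ℝ) (dZ : K → ℝ)
    (hZ : ∀ q, (Z q - dZ q • (1 : Matrix (σ q) (σ q) ℝ)).PosSemidef) (r : V → ℝ)
    (hr : ∀ v, r v = c v - ∑ e, lam e * rowE e v + ∑ i, κ i * rowI i v - ∑ q, (Z q * Fm q v).trace)
    {lo : ℚ}
    (hlo : ((lo : ℚ) : ℝ) ≤ c₀ + r u + ∑ e, lam e * rhs e - ∑ i, κ i * upper i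
      - ∑ q, (Z q * Cb q).trace - ∑ v ∈ Finset.univ.erase u, |r v| * ρ v
      - ∑ q, |min 0 (dZ q)| * τ q) :
    LowerRow F a b lo :=
  lowerRow_of_isSectorRelaxationLMI hF ha hb (henc.isSectorRelaxationLMI hP) lam κ hκ Z dZ hZ r hr
    hlo

end LMIForm

/-! ## The reader-shaped statement: a `certsdp-conic/1` `dyadic-eig` certificate on an LMI encoding -/

section DyadicEig

variable {V : Type*} [Fintype V] [DecidableEq V] {E : Type*} [Fintype E] {I : Type*} [Fintype I]
  {K : Type*} [Fintype K] {σ : K → Type*} [∀ q, Fintype (σ q)] [∀ q, DecidableEq (σ q)]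
  {π : K → Type*} [∀ q, Fintype (π q)]

/-- **END-TO-END: a conic certificate with Cholesky-residual-witnessed multipliers on an LMI encoding
IS a lower row.** Symmetric model `F`, `a, b ≤ k`; an LMI-form programme relaxing the `(a, b)`
sector energy (`IsSectorRelaxationLMI`, e.g. from `IsEncodingOfLMI` + `IsNecessaryInSector`).
Certificate (the checks of a reader of certsdp-conic/1, PSD mode `dyadic-eig`, verbatim the hypotheses
of `DyadicEigCertificate.bound`): `λ_e` free, `κ_i ≥ 0`, real SYMMETRIC `Z_k` with witnesses
`(R_k, d_k > 0, t_k > 0, σ_k, r_k)`, every row of the exact residual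
`E_k = t_k² d_k·Z_k − t_k σ_k·1 − R_kᴴ R_k` having absolute row sum `≤ r_k`; exact stationarity
residuals `r_v` and `β = c₀ + r_u + Σ_e λ_e rhs_e − Σ_i κ_i upper_i − Σ_k ⟨Z_k, C_k⟩`. Then every
rational `lo ≤ β − Σ_{v≠u} |r_v| ρ_v − Σ_k |min(0, (t_k σ_k − r_k)/(t_k² d_k))| τ_k` satisfies
`LowerRow F a b lo`. A COROLLARY (composition of `DyadicEigCertificate.bound` with the sector ground
state), not a printed statement; NOT COVERED: the float solver / float Cholesky, the reader's parsing,
the per-generator encoding property. [cite: Jansson2007, §7 Cor. 7.1 (a), p.14]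
[cite: JanssonChaykinKeil2008, Lemma 3.1 / Thm 3.2 via tree decl `lmiForm_bound`]
[cite: Rump1999VerifiedLargeSystems, §4 Alg. 4.1 step 7 via tree decl
`DyadicCholResidualWitness.posSemidef_sub_smul_one`] -/
theorem lowerRow_of_dyadicEigCertificate {F : Model k} (hF : F.IsSymmetric) {a b : ℕ} (ha : a ≤ k)
    (hb : b ≤ k) {c : V → ℝ} {c₀ : ℝ} {u : V} {rowE : E → V → ℝ} {rhs : E → ℝ} {rowI : I → V → ℝ}
    {upper : I → ℝ} {Cb : ∀ q, Matrix (σ q) (σ q) ℝ} {Fm : ∀ q, V → Matrix (σ q) (σ q) ℝ}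
    {ρ : V → ℝ} {τ : K → ℝ}
    (hrel : IsSectorRelaxationLMI F a b c c₀ u rowE rhs rowI upper Cb Fm ρ τ)
    (lam : E → ℝ) (κ : I → ℝ) (hκ : ∀ i, 0 ≤ κ i) (Z : ∀ q, Matrix (σ q) (σ q) ℝ)
    (hZh : ∀ q, (Z q).IsHermitian) (Rw : ∀ q, Matrix (π q) (σ q) ℝ) (dd tt sg rr : K → ℝ)
    (hdd : ∀ q, 0 < dd q) (htt : ∀ q, 0 < tt q)
    (hrow : ∀ q i,
      ∑ j, ‖DyadicCholResidualWitness.residual (Z q) (Rw q) (dd q) (tt q) (sg q) i j‖ ≤ rr q)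
    (r : V → ℝ)
    (hr : ∀ v, r v = c v - ∑ e, lam e * rowE e v + ∑ i, κ i * rowI i v - ∑ q, (Z q * Fm q v).trace)
    (β : ℝ)
    (hβ : β = c₀ + r u + ∑ e, lam e * rhs e - ∑ i, κ i * upper i - ∑ q, (Z q * Cb q).trace)
    {lo : ℚ}
    (hlo : ((lo : ℚ) : ℝ) ≤ β - ∑ v ∈ Finset.univ.erase u, |r v| * ρ v
      - ∑ q, |min 0 ((tt q * sg q - rr q) / (tt q ^ 2 * dd q))| * τ q) :
    LowerRow F a b lo := by
  obtain ⟨ψ, hψ, hψ1, hHψ⟩ := exists_unit_eigen_sectorGroundEnergy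
    (Model.hamiltonian_isHermitian hF) (by simpa using ha) (by simpa using hb)
  obtain ⟨y, hyu, hρ, heq, hineq, hpsd, hτ, hobj⟩ := hrel ψ hψ hψ1
  have hcert := DyadicEigCertificate.bound c c₀ u rowE rhs rowI upper Cb Fm ρ τ hyu hρ heq hineq
    hpsd hτ lam κ hκ Z hZh Rw dd tt sg rr hdd htt hrow r hr β hβ
  have hE := energy_eq_re_rayleigh_of_eigen (F := F) (a := a) (b := b) hψ1 hHψ
  exact ⟨ha, hb, by linarith⟩

end DyadicEig

end APosteriori

end Summit.Ventures.CertifiedQuantumChemistry
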